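import Summits.CriticalPhenomena.CardyFormulaZ2.Theorems.CardyMagicRigidityNestingRigidityNeckZ2NodeReimer
import HarnessLib

/-!
# Crux `NestingRigidity`, line `pinch-resampling` (v4), stub S12: Reimer glue with SPATIAL exemptions, and the summation plan for the necklace bound

Crux `Summit.CriticalPhenomena.CardyFormulaZ2.Theses.CardyMagicRigidity.NestingRigidity`
(stmt-CriticalPhenomena-4835), line `pinch-resampling` v4, stub S12 `stub_neckHookupCoarseZ2 : NeckHookupCoarseZ2`.
Sequel of `…NeckZ2NodeReimer` (worker W1, wave 5): the same glued bound, but an arm may now share its cluster with the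
crossing clusters of a node provided its annulus is DISJOINT from the node's annulus (`real_fourArm_and_arms_le`,
registered anchor: witnesses are separated by cluster or by space).  This is the form consumed by the summation of
the corrected `𝔄`-target `ZNodeAbsBoundChainA` (`…NeckZ2ErrorCoverChain`), whose plan (paper level) follows.

**Plan for `ZNodeAbsBoundChainA`.**  Data (`ZNodeEventChainA`): locales `X = {p₁,…,p_k}` on the inner layer in rank
order, pairwise distinct open clusters `Y₀,…,Y_k`, `Y_m` touching `p_m, p_{m+1}` (`Y₀ ∋ b`, `Y_k ∋ b'` crossings),
and big clusters `Y_{T_i}`, `T_i ∈ {i-1,i}` (reach `≥ lam/2 - ℓ` from `p_i`): `Y_m` has certified reach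
`span_m ≥ max(d(p_m,p_{m+1}), lam/2·[m big]) - ℓ` about `p_m`, and `≥ k/2 - 1` indices `m ∈ [1,k-1]` are big.
(1) Single-linkage hierarchy of `X`; node `Q`: radius `Δ_Q`, gap `G_Q = d(Q, X ∖ Q)` (`s` at the root),
`ρ_Q = G_Q/(Δ_Q+ℓ)`, annulus `N_Q = zAnn(w_Q, 2Δ_Q+2ℓ, G_Q/4)` (pairwise disjoint), GOOD iff `ρ_Q ≥ M`; crossing
clusters `U_Q = Y_{i₁-1}`, `V_Q = Y_{j₁}` of the first rank-run `[i₁…j₁]` of `Q` (distinct, touch `Q`, reach `X ∖ Q` or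
the outer layer) ⇒ `fourArmTwoClustersAt` on `N_Q`; ONLY good nodes are used (bad ones give nothing and block nothing).
(2) Entropy of `X` at resolution `ℓ`: `log(s/ℓ) + Σ_gaps log(g/ℓ) + O(k)`, and (Cartesian-tree induction on
`Φ(Q) = Σ_{gaps in Q} log g - Σ_{Q' ⊊ Q} log⁺ ρ_{Q'}`, `Φ(Q) ≤ (log 3)(|Q| - 1) - log(Δ_Q + 1)`, using
`log(Δ+1) + log⁺(h/(Δ+1)) ≥ log max(Δ+1, h)`): `Σ_gaps log(g/ℓ) ≤ Σ_{Q ≠ root} log⁺ ρ_Q + (log 3) k` (leaves are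
nodes, `ρ_leaf = G/ℓ`).
(3) Node gains `(1+ε) Σ_good log ρ_Q - O(#good)`; bad nodes cost `≤ log M + O(1)` each, `#nodes ≤ 2k`.
(4) Arms (WLOG `α ≤ ε/4`; spans capped at `lam/2`): `Y_m` lends ONE arm across a dyadic sub-annulus `[a_m, b_m]`
(recorded in the skeleton: `O(log log(lam/ℓ))` nats) of `zAnn(p_m, ℓ, span_m)` free of the annuli of the `γ_m` GOOD
nodes with `Y_m ∈ {U_Q,V_Q}` (seen from `p_m` these occupy radial ranges of log-width `≤ log ρ_Q + O(1)`; all other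
nodes: cluster exemption of `real_fourArm_and_arms_le`); `Σ_m γ_m = 2·#good`, the conflicting log-widths satisfy
`Σ_m Λ_m ≤ 2 Σ_good log ρ_Q + O(#good) =: 2G + O(k)`; gain `α (log(span_m/ℓ) - Λ_m)⁺/(γ_m+1) - log C`.
(5) Balance (`δ = ε/2` in the code lengths): entropy minus node gains `≤ k (2 log M + O(1)) - (ε/2) G`; arm gain `≥ α Σ_{m big} (3 log L - Λ_m)⁺/(γ_m+1) - k log C ≥
α [(3(k/2-1) log L - 2G)⁺]² / (15 k log L) - k log C` (Cauchy–Schwarz with `Σ_m (γ_m+1) ≤ 5k`).  If `G ≥ (k/2) log L`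
the term `(ε/2) G` pays `k(2 log M + O(1))`; else the arms give `≥ α k log L/60`: either way the surplus is
`≥ k (min(ε/4, α/60) log L - O(log M + log C + log log(lam/ℓ)))`, and `log(lam/ℓ) ≥ 3 log L` makes this
`≥ c₁ k log L`; for bounded `k ≤ k₀` the lineage of `p₁` telescopes (`Σ_{lineage} log ρ_Q ≥ log(Δ_X/ℓ) - O(k₀ log k₀)`,
root `ε log(s/Δ_X)`) to a surplus `≥ ε log(s/ℓ) - O_{k₀,M}(1)`.  Kraft over skeletons (cells of `X` at resolution `ℓ`
by gaps, `+` arm sub-annuli) then gives `P(ZNodeEventChainA) ≤ k₀ C_{k₀} (ℓ/s)^{ε} + Σ_{k>k₀} L^{-c₁ k} ≤ b` for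
`L ≥ L(b)`.  The window `s³ℓ ≤ lam⁴` is not used (only `s/ℓ ≥ L⁴`, `lam/ℓ ≥ L³`).
-/

noncomputable section

namespace Summit.CriticalPhenomena.CardyFormulaZ2.Cruxes.NestingRigidity.PinchResampling

open MeasureTheory Set Literature.Probability.Percolation Literature.Probability.LatticeModels
open ZPinchLocality

namespace NeckCoarseZ2

variable {ω : BondConfig (Site 2)}

/-! ## §1 The deterministic core with spatial exemptions -/

/-- **Disjoint occurrence of the four-arm events and the arm events, with spatial exemptions** (deterministic core
of `real_fourArm_and_arms_le`): on a lattice configuration, crossings of the annuli as in the four-arm events and arms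
of pairwise distinct clusters, each arm either avoiding the crossings' starts of a node or having its annulus disjoint
from the node's annulus, give `ω ∈ (⋂ four-arm events) □ (arm event □ arm event □ ⋯)`. -/
theorem mem_fourArm_disjointOccurrence_arms' (hHG : ∀ a b, (openGraph ω).Adj a b → (zdGraph 2).Adj a b)
    {ι κ : Type*} (t : Finset ι) (w : ι → Site 2) (r R : ι → ℕ) (hrR : ∀ a ∈ t, 1 ≤ r a ∧ r a ≤ R a)
    (l : List κ) (hl : l.Nodup) (w' : κ → Site 2) (r' R' : κ → ℕ) (hrR' : ∀ i ∈ l, r' i ≤ R' i)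
    (p₁ q₁ p₂ q₂ : ι → Site 2) (c : κ → Site 2)
    (h4a : ∀ a ∈ t, zNorm (p₁ a - w a) = r a ∧ zNorm (q₁ a - w a) = R a ∧ zNorm (p₂ a - w a) = r a ∧
      zNorm (q₂ a - w a) = R a ∧ PathIn (openGraph ω) (zAnn (w a) (r a) (R a)) (p₁ a) (q₁ a) ∧
      PathIn (openGraph ω) (zAnn (w a) (r a) (R a)) (p₂ a) (q₂ a) ∧
      ¬ PathIn (openGraph ω) (zAnn (w a) (r a) (R a)) (p₁ a) (p₂ a))
    (harm : ∀ i ∈ l, zNorm (c i - w' i) < r' i ∧ ∃ q, (R' i : ℤ) ≤ zNorm (q - w' i) ∧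
      PathIn (openGraph ω) univ (c i) q)
    (hdist : ∀ i ∈ l, ∀ j ∈ l, i ≠ j → ¬ PathIn (openGraph ω) univ (c i) (c j))
    (havoid : ∀ i ∈ l, ∀ a ∈ t, (¬ PathIn (openGraph ω) univ (c i) (p₁ a) ∧ ¬ PathIn (openGraph ω) univ (c i) (p₂ a)) ∨
      Disjoint (zAnn (w' i) (r' i) (R' i)) (zAnn (w a) (r a) (R a))) :
    ω ∈ (⋂ a ∈ t, fourArmTwoClustersAt (w a) (r a) (R a)) □
      disjointOccurrenceList (l.map fun i ↦ zOneArmAt (w' i) (r' i) (R' i)) := by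
  classical
  -- finite witnesses of the crossings
  have hw₁ : ∀ a ∈ t, ∃ W : Finset (Sym2 (Site 2)), ↑W ⊆ ω ∧
      PathIn (openGraph ↑W) (zAnn (w a) (r a) (R a)) (p₁ a) (q₁ a) ∧
      ∀ e ∈ W, ∀ z ∈ e, PathIn (openGraph ω) (zAnn (w a) (r a) (R a)) (p₁ a) z :=
    fun a ha ↦ exists_finset_witness_of_pathIn (h4a a ha).2.2.2.2.1
  have hw₂ : ∀ a ∈ t, ∃ W : Finset (Sym2 (Site 2)), ↑W ⊆ ω ∧
      PathIn (openGraph ↑W) (zAnn (w a) (r a) (R a)) (p₂ a) (q₂ a) ∧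
      ∀ e ∈ W, ∀ z ∈ e, PathIn (openGraph ω) (zAnn (w a) (r a) (R a)) (p₂ a) z :=
    fun a ha ↦ exists_finset_witness_of_pathIn (h4a a ha).2.2.2.2.2.1
  choose! W₁ hW₁ω hW₁p hW₁c using hw₁
  choose! W₂ hW₂ω hW₂p hW₂c using hw₂
  -- finite witnesses of the arms, inside the clusters of the `c i`
  have key : ∀ i ∈ l, ∃ K : Finset (Sym2 (Site 2)), ↑K ⊆ ω ∧
      (↑K : Set (Sym2 (Site 2))) ∈ zOneArmAt (w' i) (r' i) (R' i) ∧
      ∀ e ∈ K, ∀ z ∈ e, PathIn (openGraph ω) univ (c i) z ∧ z ∈ zAnn (w' i) (r' i) (R' i) := by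
    intro i hi
    obtain ⟨hnear, q, hqR, hpath⟩ := harm i hi
    obtain ⟨p, q', hp, hq', hcross, hcp⟩ := exists_zAnn_crossing_of_pathIn hHG (hrR' i hi) hnear hqR hpath
    obtain ⟨K, hKω, hK, hKu⟩ := exists_finset_witness_of_pathIn hcross
    exact ⟨K, hKω, ⟨p, q', hp, hq', hK.mono inter_subset_right⟩, fun e he z hz ↦
      ⟨hcp.trans ((hKu e he z hz).mono inter_subset_left), ((hKu e he z hz).right_mem).2⟩⟩
  choose! K hKω hKA hKc using key
  -- the cylinder of the four-arm events
  have hcyl : localCylinder (⋃ a ∈ t, (↑(W₁ a) ∪ ↑(W₂ a) ∪ ((zAnn (w a) (r a) (R a)).sym2 \ ω))) ω ⊆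
      ⋂ a ∈ t, fourArmTwoClustersAt (w a) (r a) (R a) := by
    intro ω' hω'
    refine mem_iInter₂.2 fun a ha ↦ ?_
    obtain ⟨hp₁, hq₁, hp₂, hq₂, -, -, hn⟩ := h4a a ha
    exact localCylinder_subset_fourArm (hrR a ha).1 (hrR a ha).2 hp₁ hq₁ hp₂ hq₂ (hW₁ω a ha) (hW₂ω a ha)
      (hW₁p a ha) (hW₂p a ha) hn
      (fun e he ↦ hω' e (mem_biUnion ha he))
  have hmem := mem_inter_disjointOccurrenceList_of_witnesses hcyl
    (l.map fun i ↦ (zOneArmAt (w' i) (r' i) (R' i), (↑(K i) : Set (Sym2 (Site 2)))))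
    (fun q hq ↦ by
      obtain ⟨i, -, rfl⟩ := List.mem_map.1 hq
      exact isUpperSet_zOneArmAt _ _ _)
    (fun q hq ↦ by
      obtain ⟨i, hi, rfl⟩ := List.mem_map.1 hq
      exact hKA i hi)
    (fun q hq ↦ by
      obtain ⟨i, hi, rfl⟩ := List.mem_map.1 hq
      exact hKω i hi)
    ?_ ?_
  · rw [List.map_map] at hmem
    exact hmem
  · -- arms in distinct clusters have edge-disjoint witnesses
    rw [List.pairwise_map]
    refine hl.pairwise_of_forall_ne fun i hi j hj hij ↦ ?_
    rw [Finset.disjoint_coe, Finset.disjoint_left]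
    intro e hei hej
    obtain ⟨z, hz⟩ : ∃ z, z ∈ e := ⟨e.out.1, Sym2.out_fst_mem e⟩
    exact hdist i hi j hj hij ((hKc i hi e hei z hz).1.trans (hKc j hj e hej z hz).1.symm)
  · -- arm witnesses avoid the cylinder: they are open (not closed), and in other clusters than the crossings
    intro q hq
    obtain ⟨i, hi, rfl⟩ := List.mem_map.1 hq
    rw [Set.disjoint_iUnion₂_left]
    intro a ha
    rw [Set.disjoint_left]
    rcases havoid i hi a ha with hcl | hsp
    · -- separated by cluster
      rintro e (⟨he | he⟩ | he) heK
      · obtain ⟨z, hz⟩ : ∃ z, z ∈ e := ⟨e.out.1, Sym2.out_fst_mem e⟩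
        exact hcl.1 ((hKc i hi e heK z hz).1.trans (((hW₁c a ha e he z hz).mono (subset_univ _)).symm))
      · obtain ⟨z, hz⟩ : ∃ z, z ∈ e := ⟨e.out.1, Sym2.out_fst_mem e⟩
        exact hcl.2 ((hKc i hi e heK z hz).1.trans (((hW₂c a ha e he z hz).mono (subset_univ _)).symm))
      · exact he.2 (hKω i hi heK)
    · -- separated by space: the cylinder part lies over the node annulus, the arm witness over the arm annulus
      intro e he heK
      have heK' : e ∈ (zAnn (w' i) (r' i) (R' i)).sym2 :=
        Set.mem_sym2_iff_subset.2 fun z hz ↦ (hKc i hi e heK z hz).2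
      have he' : e ∈ (zAnn (w a) (r a) (R a)).sym2 := by
        rcases he with (he | he) | he
        · exact Set.mem_sym2_iff_subset.2 fun z hz ↦ (hW₁c a ha e he z hz).right_mem
        · exact Set.mem_sym2_iff_subset.2 fun z hz ↦ (hW₂c a ha e he z hz).right_mem
        · exact he.1
      exact Set.disjoint_left.1 (disjoint_sym2_of_disjoint hsp) heK' he'

end NeckCoarseZ2

/-! ## §2 The glued bound -/

/-- **Four-arm node events over disjoint annuli AND arms of pairwise distinct clusters, with spatial exemptions
(registered helper, anchor of this module on the crux item).**  As `real_fourArm_and_distinctArms_le`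
(`…NeckZ2NodeReimer`), but for each pair (arm `i`, node `a`) it suffices that EITHER the cluster of `c i` contains
neither `p₁ a` nor `p₂ a`, OR the arm annulus `zAnn (w' i) (r' i) (R' i)` is disjoint from the node annulus
`zAnn (w a) (r a) (R a)`; the bound is `(∏ c (r a / R a)^{1+ε}) · ∏ C (r' i / (R' i - 1))^α`. -/
theorem real_fourArm_and_arms_le : ∃ c ε C α : ℝ, 0 < c ∧ 0 < ε ∧ 0 < C ∧ 0 < α ∧ ∀ (ι κ : Type) (t : Finset ι) (w : ι → Site 2) (r R : ι → ℕ) (u : Finset κ) (w' : κ → Site 2) (r' R' : κ → ℕ), (∀ a ∈ t, 1 ≤ r a ∧ r a ≤ R a) → (↑t : Set ι).PairwiseDisjoint (fun a ↦ NeckCoarseZ2.zAnn (w a) (r a) (R a)) → (∀ i ∈ u, 1 ≤ r' i ∧ r' i + 1 ≤ R' i) → (bondPercolation (zdGraph 2) half).real {ω | ∃ (p₁ q₁ p₂ q₂ : ι → Site 2) (c : κ → Site 2), (∀ a ∈ t, zNorm (p₁ a - w a) = r a ∧ zNorm (q₁ a - w a) = R a ∧ zNorm (p₂ a - w a) = r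 a ∧ zNorm (q₂ a - w a) = R a ∧ PathIn (openGraph ω) (NeckCoarseZ2.zAnn (w a) (r a) (R a)) (p₁ a) (q₁ a) ∧ PathIn (openGraph ω) (NeckCoarseZ2.zAnn (w a) (r a) (R a)) (p₂ a) (q₂ a) ∧ ¬ PathIn (openGraph ω) (NeckCoarseZ2.zAnn (w a) (r a) (R a)) (p₁ a) (p₂ a)) ∧ (∀ i ∈ u, zNorm (c i - w' i) < r' i ∧ ∃ q, (R' i : ℤ) ≤ zNorm (q - w' i) ∧ PathIn (openGraph ω) Set.univ (c i) q) ∧ (∀ i ∈ u, ∀ j ∈ u, i ≠ j → ¬ PathIn (openGraph ω) Set.univ (c i) (c j)) ∧ (∀ i ∈ u, ∀ a ∈ t, (¬ PathIn (openGraph ω) Set.univ (c i) (p₁ a) ∧ ¬ PathIn (openGraph ω) Set.univ (c i) (p₂ a)) ∨ Disjoint (NeckCoarseZ2.zAnn (w' i) (r' i) (R' i)) (NeckCoarseZ2.zAnn (w a) (r a) (R a)))} ≤ (∏ a ∈ t, c * ((r a : ℝ) / R a) ^ (1 + ε)) * ∏ i ∈ u, C * ((r' i : ℝ) / ((R' i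 - 1 : ℕ) : ℝ)) ^ α := by
  obtain ⟨c, ε, hc, hε, h4⟩ := real_biInter_fourArmTwoClustersAt_le_prod_rpow
  obtain ⟨C, α, hC, hα, h1⟩ := NeckCoarseZ2.real_zOneArmAt_le
  refine ⟨c, ε, C, α, hc, hε, hC, hα, fun ι κ t w r R u w' r' R' hrR hdisj hrR' ↦ ?_⟩
  classical
  obtain ⟨E, hE⟩ : ∃ E : Set (BondConfig (Site 2)), E = {ω | ∃ (p₁ q₁ p₂ q₂ : ι → Site 2) (c : κ → Site 2),
      (∀ a ∈ t, zNorm (p₁ a - w a) = r a ∧ zNorm (q₁ a - w a) = R a ∧ zNorm (p₂ a - w a) = r a ∧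
        zNorm (q₂ a - w a) = R a ∧ PathIn (openGraph ω) (NeckCoarseZ2.zAnn (w a) (r a) (R a)) (p₁ a) (q₁ a) ∧
        PathIn (openGraph ω) (NeckCoarseZ2.zAnn (w a) (r a) (R a)) (p₂ a) (q₂ a) ∧
        ¬ PathIn (openGraph ω) (NeckCoarseZ2.zAnn (w a) (r a) (R a)) (p₁ a) (p₂ a)) ∧
      (∀ i ∈ u, zNorm (c i - w' i) < r' i ∧ ∃ q, (R' i : ℤ) ≤ zNorm (q - w' i) ∧
        PathIn (openGraph ω) Set.univ (c i) q) ∧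
      (∀ i ∈ u, ∀ j ∈ u, i ≠ j → ¬ PathIn (openGraph ω) Set.univ (c i) (c j)) ∧
      (∀ i ∈ u, ∀ a ∈ t, (¬ PathIn (openGraph ω) Set.univ (c i) (p₁ a) ∧
        ¬ PathIn (openGraph ω) Set.univ (c i) (p₂ a)) ∨
        Disjoint (NeckCoarseZ2.zAnn (w' i) (r' i) (R' i)) (NeckCoarseZ2.zAnn (w a) (r a) (R a)))} := ⟨_, rfl⟩
  rw [← hE]
  set μ := bondPercolation (zdGraph 2) half with hμ
  set L := u.toList.map fun i ↦ NeckCoarseZ2.zOneArmAt (w' i) (r' i) (R' i) with hL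
  set A := ⋂ a ∈ t, fourArmTwoClustersAt (w a) (r a) (R a) with hA
  -- off a null set, the event implies the disjoint occurrence of `A` and the arm events
  have hcover : E ∩ {ω | ω ⊆ (zdGraph 2).edgeSet} ⊆ A □ disjointOccurrenceList L := by
    rintro ω ⟨hω, hlat⟩
    rw [hE] at hω
    obtain ⟨p₁, q₁, p₂, q₂, cc, h4a, harm, hdist, havoid⟩ := hω
    have hHG : ∀ a b, (openGraph ω).Adj a b → (zdGraph 2).Adj a b := fun a b h ↦
      (SimpleGraph.mem_edgeSet _).1 (hlat ((openGraph_adj ω a b).1 h).1)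
    exact NeckCoarseZ2.mem_fourArm_disjointOccurrence_arms' hHG t w r R hrR u.toList (Finset.nodup_toList u)
      w' r' R' (fun i hi ↦ by have := (hrR' i (Finset.mem_toList.1 hi)).2; omega) p₁ q₁ p₂ q₂ cc h4a
      (fun i hi ↦ harm i (Finset.mem_toList.1 hi))
      (fun i hi j hj hij ↦ hdist i (Finset.mem_toList.1 hi) j (Finset.mem_toList.1 hj) hij)
      fun i hi a ha ↦ havoid i (Finset.mem_toList.1 hi) a ha
  have hae : ∀ᵐ ω ∂μ, ω ⊆ (zdGraph 2).edgeSet := ae_subset_edgeSet (zdGraph 2) half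
  have heq : μ.real E = μ.real (E ∩ {ω | ω ⊆ (zdGraph 2).edgeSet}) := by
    refine measureReal_congr (Filter.eventuallyEq_set.2 (hae.mono fun ω hω ↦ ?_))
    simp only [mem_inter_iff, mem_setOf_eq, hω, and_true]
  have hup : ∀ D ∈ L, IsUpperSet D := fun D hD ↦ by
    obtain ⟨i, -, rfl⟩ := List.mem_map.1 hD
    exact NeckCoarseZ2.isUpperSet_zOneArmAt _ _ _
  have hfin : ∀ D ∈ L, IsFinitary D := fun D hD ↦ by
    obtain ⟨i, -, rfl⟩ := List.mem_map.1 hD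
    exact NeckCoarseZ2.isFinitary_zOneArmAt _ _ _
  have hAloc : IsLocalEvent A := NeckCoarseZ2.isLocalEvent_biInter_fourArm t w r R fun a ha ↦ (hrR a ha).1
  have hreimer : μ.real (A □ disjointOccurrenceList L) ≤ μ.real A * (L.map μ.real).prod := by
    have h := reimer_local_finitary_list (zdGraph 2) half hAloc isUpperSet_univ isFinitary_univ L hup hfin
    rwa [inter_univ] at h
  have hprod : (L.map μ.real).prod = ∏ i ∈ u, μ.real (NeckCoarseZ2.zOneArmAt (w' i) (r' i) (R' i)) := by
    rw [hL, List.map_map, Function.comp_def, Finset.prod_map_toList]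
  have hA4 : μ.real A ≤ ∏ a ∈ t, c * ((r a : ℝ) / R a) ^ (1 + ε) := h4 ι t w r R hrR hdisj
  calc μ.real E = μ.real (E ∩ {ω | ω ⊆ (zdGraph 2).edgeSet}) := heq
    _ ≤ μ.real (A □ disjointOccurrenceList L) := measureReal_mono hcover (measure_ne_top _ _)
    _ ≤ μ.real A * (L.map μ.real).prod := hreimer
    _ = μ.real A * ∏ i ∈ u, μ.real (NeckCoarseZ2.zOneArmAt (w' i) (r' i) (R' i)) := by rw [hprod]
    _ ≤ (∏ a ∈ t, c * ((r a : ℝ) / R a) ^ (1 + ε)) * ∏ i ∈ u, C * ((r' i : ℝ) / ((R' i - 1 : ℕ) : ℝ)) ^ α :=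
        mul_le_mul hA4 (Finset.prod_le_prod (fun i _ ↦ measureReal_nonneg)
          fun i hi ↦ h1 (w' i) (r' i) (R' i) (hrR' i hi).1 (hrR' i hi).2)
          (Finset.prod_nonneg fun i _ ↦ measureReal_nonneg) (le_trans measureReal_nonneg hA4)

end Summit.CriticalPhenomena.CardyFormulaZ2.Cruxes.NestingRigidity.PinchResampling

end
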